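import Literature.NumberTheory.Automorphic.LanglandsTunnellBridgeEigenModel
import Literature.NumberTheory.Automorphic.CuspidalTransposeInv
import Literature.NumberTheory.Automorphic.LocalComponentBJ
import HarnessLib

/-!
# The eigen-model of a cuspidal automorphic representation of `GL_n(𝔸_K)` has the same local
# components, and so does its transpose (Borel–Jacquet 1979, 5.7: "`π = π₀ ⊗ χ`")

Topic `Literature/NumberTheory/Automorphic`; proof file (theorems only: no definition, no named
fact, no instance).  Companion of `LanglandsTunnellBridgeEigenModel`
(`CuspidalAutomorphicRepData.exists_eigenModel_hasSatakeParamAt`): for a cuspidal Borel–Jacquet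
datum `π = W / W'` of `GL_n(𝔸_K)` with ARBITRARY behaviour on the split centre `A_G`, the
eigen-model `π₁ = W₁ / W₁'`, `W₁ = N(M)`, `W₁' = N(M ∩ W')` (`M = W ∩ ker S_μ^{k₀}`,
`N = S_μ^{k₀ - 1}`, `S_μ = 1 - μ` the shifted Lie derivative along the central `1 ∈ 𝔤`) is a
cuspidal datum on whose whole space `A_G` acts by the character `a ↦ a^μ`.  The model is NOT a
sub-datum of `π` in general (`W₁ ⊆ W'` as soon as `k₀ ≥ 2`), but `N` induces an isomorphism
`M / (M ∩ W') ≅ W₁ / W₁'` of `(𝔤, K_∞) × GL_n(𝔸_K^∞)`-modules and `M + W' = W`, so `π₁ ≅ π`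
abstractly; this file records the consequence the standard `L`-function theory needs:

* `AutomorphicRepData.hasLocalComponentAt_of_model` — **local components transfer along a
  model**: if `A.W = N(M)` for a subspace `M ≤ B.W` stable under `GL_n(𝔸_K^∞)` and a map `N`,
  additive and homogeneous on `M`, commuting with finite-adelic right translations, with
  `N m ∈ A.W' ↔ m ∈ B.W'` for `m ∈ M`, then every local component of `A` at a finite place is a
  local component of `B` (the intertwiner `V → A.W` is lifted through a linear section of
  `N : M ↠ A.W`; Flath 1979, Thm. 3; Borel–Jacquet 1979, §4.6);
* `CuspidalAutomorphicRepData.exists_eigenModel_hasLocalComponentAt` — **the eigen-model with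
  local components**: every cuspidal `π` has a cuspidal `π₁` and `μ ∈ ℂ` with `A_G` acting on
  `W₁` by `a ↦ a^μ`, every local component of `π₁` (at any finite place) being a local component
  of `π`, AND every local component of the transpose `π₁^τ` (`CuspidalAutomorphicRepData.transposeInv`,
  `φ ↦ φ ∘ τ`, `τ(g) = w₀ ᵗg⁻¹ w₀`) being a local component of `π^τ` (the transfer lemma applied to
  `N` on `M` and to `τ ∘ N ∘ τ` on `M ∘ τ`; `τ` commutes with right translations up to `τ`,
  `rightTranslation_funLeft_weylLong_mul_glTransposeInv_mul_weylLong`).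

Consequently (the use in `StandardLTheoryGL2`/`GlobalHeckeTheoryGL2OfCenterInvariant`): `π` and
its eigen-model have the same canonical local Euler polynomials at every finite place, and so do
`π^τ` and `π₁^τ`, so that the global Hecke theory may assume, after the twist
`π₀ = π₁ ⊗ |det|^{-μ/(n[K:ℚ])}` (`AutomorphicTwistNorm`), that the cusp forms are `A_G`-invariant
— Jacquet–Langlands' "`|η(det g)|^{-1/2} φ(g)` is bounded" (1970, proof of Thm. 11.1, p. 171) and
Borel–Jacquet's "`π = π₀ ⊗ χ` with `π₀` unitary" (1979, 5.7).

## References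

* A. Borel, H. Jacquet, *Automorphic forms and automorphic representations*, Proc. Sympos. Pure
  Math. 33.1 (1979), §4.6, 5.7. [BorelJacquetCorvallis1979]
* D. Flath, *Decomposition of representations into tensor products*, Proc. Sympos. Pure Math.
  33.1 (1979), Thm. 3. [FlathCorvallis1979]
* H. Jacquet, R. P. Langlands, *Automorphic Forms on GL(2)*, LNM 114 (1970), proof of Thm. 11.1,
  p. 171. [JacquetLanglands1970]
-/

-- Mathlib idiom (Mathlib/Algebra/Lie/OfAssociative.lean); needed to mention Lie subalgebras of matrix algebras
attribute [local instance 100] LieRing.ofAssociativeRing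

noncomputable section

open scoped MatrixGroups NNReal Classical
open NumberField NumberField.mixedEmbedding IsDedekindDomain MeasureTheory Filter

namespace Literature.NumberTheory.Automorphic

open Literature.NumberTheory.GaloisRepresentations (glTransposeInv)

variable {n : ℕ} {K : Type} [Field K] [NumberField K] {hcpt : isCompact_glFiniteIntegralLevel n K}

set_option quotPrecheck false in
/-- `S_μ ψ = 1·ψ - μ ψ`, the shifted Lie derivative along the central element `1 ∈ 𝔤𝔩_n(K_∞)`
(local notation, verbatim that of `AutomorphicRepsGLCleanModel`). -/
local notation "S[" hc ", " μ "]" =>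
  (fun ψ : (AdelicGroupData.gl n K).Adelic → ℂ =>
    lieDeriv (AutomorphyDatum.gl n K hc).ofArch (⟨1, trivial⟩ : (AutomorphyDatum.gl n K hc).arch.lie) ψ - μ • ψ)

local notation "τ𝔸[" g "]" => weylLong n (AdeleRing (𝓞 K) K) *
  glTransposeInv (Fin n) (AdeleRing (𝓞 K) K) g * weylLong n (AdeleRing (𝓞 K) K)
set_option quotPrecheck false in
local notation "τ𝔸⋆" => LinearMap.funLeft ℂ ℂ (m := (AdelicGroupData.gl n K).Adelic)
  (n := (AdelicGroupData.gl n K).Adelic) fun g => τ𝔸[g]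

/-! ### Local components transfer along a model -/

/-- **Local components transfer along a model.** Let `A = A.W / A.W'`, `B = B.W / B.W'` be
Borel–Jacquet data, `M ≤ B.W` a subspace stable under the finite-adelic right translations, and
`N` a map of functions which is additive and homogeneous on `M`, commutes with the finite-adelic
right translations on `M`, has `A.W = N(M)`, and satisfies `N m ∈ A.W' ↔ m ∈ B.W'` for `m ∈ M`.
Then every local component `ρ` of `A` at a finite place `v` is a local component of `B`: an
intertwiner `f₁ : V → A.W` (non-zero and `GL_n(K_v)`-equivariant modulo `A.W'`) lifts to
`f = σ ∘ f₁ : V → M ≤ B.W` through a linear section `σ` of `N : M ↠ A.W`, and `f` is non-zero and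
equivariant modulo `B.W'` because `N` detects `B.W'` on `M`. (Flath 1979, Thm. 3: local components
are functorial in the global module.) [cite: FlathCorvallis1979, Thm. 3]
[cite: BorelJacquetCorvallis1979, §4.6] -/
theorem AutomorphicRepData.hasLocalComponentAt_of_model
    {A B : AutomorphicRepData (AutomorphyDatum.gl n K hcpt)}
    (M : Submodule ℂ ((AdelicGroupData.gl n K).Adelic → ℂ)) (hMB : M ≤ B.W)
    (hMst : ∀ h ∈ (AutomorphyDatum.gl n K hcpt).finiteAdelic, ∀ φ ∈ M,
      rightTranslation (AdelicGroupData.gl n K) h φ ∈ M)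
    (N : ((AdelicGroupData.gl n K).Adelic → ℂ) → ((AdelicGroupData.gl n K).Adelic → ℂ))
    (hNadd : ∀ a ∈ M, ∀ b ∈ M, N (a + b) = N a + N b)
    (hNsmul : ∀ (c : ℂ) (a : (AdelicGroupData.gl n K).Adelic → ℂ), N (c • a) = c • N a)
    (hNR : ∀ h ∈ (AutomorphyDatum.gl n K hcpt).finiteAdelic, ∀ φ ∈ M,
      N (rightTranslation (AdelicGroupData.gl n K) h φ) =
        rightTranslation (AdelicGroupData.gl n K) h (N φ))
    (hAW : ∀ ψ, ψ ∈ A.W ↔ ∃ φ ∈ M, N φ = ψ)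
    (hkey : ∀ φ ∈ M, N φ ∈ A.W' ↔ φ ∈ B.W')
    {v : HeightOneSpectrum (𝓞 K)} {V : Type*} [AddCommGroup V] [Module ℂ V]
    {ρ : Representation ℂ (GL (Fin n) (v.adicCompletion K)) V}
    (hρ : A.HasLocalComponentAt v ρ) : B.HasLocalComponentAt v ρ := by
  classical
  obtain ⟨f₁, hf₁W, hf₁W', hf₁⟩ := hρ
  -- `N` as a linear map on `M`, onto `A.W`
  let NL : M →ₗ[ℂ] A.W :=
    { toFun := fun m => ⟨N m, (hAW _).2 ⟨m, m.2, rfl⟩⟩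
      map_add' := fun a b => Subtype.ext (hNadd a a.2 b b.2)
      map_smul' := fun c a => Subtype.ext (hNsmul c a) }
  have hsurj : LinearMap.range NL = ⊤ := by
    refine LinearMap.range_eq_top.2 fun y => ?_
    obtain ⟨φ, hφ, hφy⟩ := (hAW y).1 y.2
    exact ⟨⟨φ, hφ⟩, Subtype.ext hφy⟩
  obtain ⟨σ, hσ⟩ := LinearMap.exists_rightInverse_of_surjective NL hsurj
  have hNσ : ∀ y : A.W,
      N ((σ y : M) : (AdelicGroupData.gl n K).Adelic → ℂ) = (y : (AdelicGroupData.gl n K).Adelic → ℂ) :=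
    fun y => congrArg Subtype.val (LinearMap.congr_fun hσ y)
  -- the transferred intertwiner `f = σ ∘ f₁ : V → M`
  let f₁' : V →ₗ[ℂ] A.W :=
    LinearMap.codRestrict A.W f₁ fun x => hf₁W (LinearMap.mem_range_self f₁ x)
  let f : V →ₗ[ℂ] ((AdelicGroupData.gl n K).Adelic → ℂ) := M.subtype ∘ₗ σ ∘ₗ f₁'
  have hfM : ∀ x, f x ∈ M := fun x => (σ (f₁' x)).2
  have hNf : ∀ x, N (f x) = f₁ x := fun x => hNσ (f₁' x)
  have hNsub : ∀ a ∈ M, ∀ b ∈ M, N (a - b) = N a - N b := fun a ha b hb => by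
    rw [sub_eq_add_neg, hNadd a ha (-b) (M.neg_mem hb), ← neg_one_smul ℂ b, hNsmul, neg_one_smul,
      ← sub_eq_add_neg]
  refine ⟨f, ?_, fun hle => ?_, fun g x => ?_⟩
  · rintro _ ⟨x, rfl⟩
    exact hMB (hfM x)
  · -- `f` is non-zero modulo `B.W'` since `N` detects `B.W'`
    refine hf₁W' ?_
    rintro _ ⟨x, rfl⟩
    rw [← hNf x]
    exact (hkey _ (hfM x)).2 (hle (LinearMap.mem_range_self f x))
  · -- equivariance modulo `B.W'`
    have hgι : (GLn.ofLocal n K v g : (AdelicGroupData.gl n K).Adelic) ∈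
        (AutomorphyDatum.gl n K hcpt).finiteAdelic := GLn.ofLocal_mem_range_ofFinite v g
    have hRM : rightTranslation (AdelicGroupData.gl n K) (GLn.ofLocal n K v g) (f x) ∈ M :=
      hMst _ hgι _ (hfM x)
    have hdM : f (ρ g x) -
        rightTranslation (AdelicGroupData.gl n K) (GLn.ofLocal n K v g) (f x) ∈ M :=
      sub_mem (hfM _) hRM
    refine (hkey _ hdM).1 ?_
    rw [hNsub _ (hfM _) _ hRM, hNR _ hgι _ (hfM x), hNf, hNf]
    exact hf₁ g x

/-! ### The eigen-model with local components -/

set_option maxHeartbeats 1600000 in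
/-- **The eigen-model of a cuspidal automorphic representation of `GL_n(𝔸_K)`, with its local
components** (Borel–Jacquet 1979, 5.7, made unconditional as in
`CuspidalAutomorphicRepData.exists_eigenModel_hasSatakeParamAt`): for every cuspidal Borel–Jacquet
datum `π = W / W'` there are a cuspidal datum `π₁ = W₁ / W₁'` and `μ ∈ ℂ` such that `A_G` acts on
all of `W₁` by `a ↦ a^μ`, every local component of `π₁` at a finite place `v` (a representation
`ρ` of `GL_n(K_v)`) is a local component of `π` at `v`, and every local component of the transpose
`π₁^τ` is a local component of `π^τ`.  Construction verbatim that of the eigen-model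
(`W₁ = N(M_{k₀})`, `W₁' = N(M_{k₀} ∩ W')`, `N = S_μ^{k₀-1}`); the transfers are
`AutomorphicRepData.hasLocalComponentAt_of_model` for `N` on `M_{k₀}` (the kernel of `N` on
`M_{k₀}` is `M_{k₀-1} ≤ W'`) and for `τ ∘ N ∘ τ` on `M_{k₀} ∘ τ`.
[cite: BorelJacquetCorvallis1979, §4.6 and 5.7] [cite: FlathCorvallis1979, Thm. 3] -/
theorem CuspidalAutomorphicRepData.exists_eigenModel_hasLocalComponentAt
    (π : CuspidalAutomorphicRepData n K hcpt) :
    ∃ (π₁ : CuspidalAutomorphicRepData n K hcpt) (μ : ℂ),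
      (∀ ψ ∈ π₁.1.W, ∀ (t : ℝ≥0ˣ) (g : (AdelicGroupData.gl n K).Adelic),
        ψ ((show (AdelicGroupData.gl n K).Adelic from posRealScalar n K t) * g) =
          (((t : ℝ≥0) : ℝ) : ℂ) ^ μ * ψ g) ∧
      (∀ (v : HeightOneSpectrum (𝓞 K)) (V : Type) [AddCommGroup V] [Module ℂ V]
        (ρ : Representation ℂ (GL (Fin n) (v.adicCompletion K)) V),
        π₁.1.HasLocalComponentAt v ρ → π.1.HasLocalComponentAt v ρ) ∧
      (∀ (v : HeightOneSpectrum (𝓞 K)) (V : Type) [AddCommGroup V] [Module ℂ V]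
        (ρ : Representation ℂ (GL (Fin n) (v.adicCompletion K)) V),
        π₁.transposeInv.1.HasLocalComponentAt v ρ → π.transposeInv.1.HasLocalComponentAt v ρ) := by
  classical
  -- (B) an eigencomponent outside `W'`
  obtain ⟨μ, k₁, φ₁, hφ₁W, hφ₁W', hφ₁k⟩ := π.1.exists_mem_iterate_shiftLie_eq_zero
  -- (C) the generalised kernels `M k = W ∩ ker S_μ^k`
  let M : ℕ → Submodule ℂ ((AdelicGroupData.gl n K).Adelic → ℂ) := fun k =>
    { carrier := {φ | φ ∈ π.1.W ∧ (S[hcpt, μ])^[k] φ = 0}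
      add_mem' := fun {a b} ha hb => ⟨add_mem ha.1 hb.1, by
        rw [iterate_shiftLie_add π.1.stable μ k ha.1 hb.1, ha.2, hb.2, add_zero]⟩
      zero_mem' := ⟨zero_mem _, iterate_shiftLie_zero μ k⟩
      smul_mem' := fun c a ha => ⟨Submodule.smul_mem _ c ha.1, by
        rw [iterate_shiftLie_smul, ha.2, smul_zero]⟩ }
  have hMmem : ∀ k φ, φ ∈ M k ↔ φ ∈ π.1.W ∧ (S[hcpt, μ])^[k] φ = 0 := fun k φ => Iff.rfl
  have hex : ∃ k, ¬ (M k ≤ π.1.W') := ⟨k₁, fun h => hφ₁W' (h ((hMmem _ _).2 ⟨hφ₁W, hφ₁k⟩))⟩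
  -- `k₀` (least with `M k₀ ⊄ W'`) and `j = k₀ - 1` as OPAQUE variables (no `Nat.find` in terms)
  obtain ⟨k₀, hk₀, hmin⟩ : ∃ k₀, ¬ (M k₀ ≤ π.1.W') ∧ ∀ k < k₀, M k ≤ π.1.W' :=
    ⟨Nat.find hex, Nat.find_spec hex, fun k hk => not_not.1 (Nat.find_min hex hk)⟩
  have hk₀pos : 0 < k₀ := by
    rw [Nat.pos_iff_ne_zero]
    intro h0
    refine hk₀ fun φ hφ => ?_
    have h2 := ((hMmem _ _).1 hφ).2
    rw [h0, Function.iterate_zero_apply] at h2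
    rw [h2]
    exact zero_mem _
  obtain ⟨j, hjk⟩ : ∃ j, j + 1 = k₀ := ⟨k₀ - 1, Nat.succ_pred_eq_of_pos hk₀pos⟩
  have hker : M j ≤ π.1.W' := hmin j (by omega)
  have hMst : IsStableSubmodule (AutomorphyDatum.gl n K hcpt) (M k₀) :=
    isStableSubmodule_of_mem_iff_iterate_eq_zero π.1.stable μ k₀ (hMmem k₀)
  have hMW : M k₀ ≤ π.1.W := fun φ hφ => ((hMmem _ _).1 hφ).1
  -- the images `NM = N(M k₀)`, `NM' = N(M k₀ ∩ W')`, `N = S_μ^j`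
  let NM : Submodule ℂ ((AdelicGroupData.gl n K).Adelic → ℂ) :=
    { carrier := {ψ | ∃ φ ∈ M k₀, (S[hcpt, μ])^[j] φ = ψ}
      add_mem' := by
        rintro _ _ ⟨a, ha, rfl⟩ ⟨b, hb, rfl⟩
        exact ⟨a + b, add_mem ha hb, iterate_shiftLie_add π.1.stable μ j (hMW ha) (hMW hb)⟩
      zero_mem' := ⟨0, zero_mem _, iterate_shiftLie_zero μ j⟩
      smul_mem' := by
        rintro c _ ⟨a, ha, rfl⟩
        exact ⟨c • a, Submodule.smul_mem _ c ha, iterate_shiftLie_smul μ j c a⟩ }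
  have hNMmem : ∀ ψ, ψ ∈ NM ↔ ∃ φ ∈ M k₀, (S[hcpt, μ])^[j] φ = ψ := fun ψ => Iff.rfl
  let NM' : Submodule ℂ ((AdelicGroupData.gl n K).Adelic → ℂ) :=
    { carrier := {ψ | ∃ φ ∈ M k₀ ⊓ π.1.W', (S[hcpt, μ])^[j] φ = ψ}
      add_mem' := by
        rintro _ _ ⟨a, ha, rfl⟩ ⟨b, hb, rfl⟩
        exact ⟨a + b, add_mem ha hb, iterate_shiftLie_add π.1.stable μ j (hMW ha.1) (hMW hb.1)⟩
      zero_mem' := ⟨0, zero_mem _, iterate_shiftLie_zero μ j⟩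
      smul_mem' := by
        rintro c _ ⟨a, ha, rfl⟩
        exact ⟨c • a, Submodule.smul_mem _ c ha, iterate_shiftLie_smul μ j c a⟩ }
  have hNM'mem : ∀ ψ, ψ ∈ NM' ↔ ∃ φ ∈ M k₀ ⊓ π.1.W', (S[hcpt, μ])^[j] φ = ψ := fun ψ => Iff.rfl
  have hNM'le : NM' ≤ NM := by
    rintro _ ⟨a, ha, rfl⟩
    exact ⟨a, ha.1, rfl⟩
  have hMW'st : IsStableSubmodule (AutomorphyDatum.gl n K hcpt) (M k₀ ⊓ π.1.W') := hMst.inf π.1.stable'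
  have hNMst : IsStableSubmodule (AutomorphyDatum.gl n K hcpt) NM :=
    isStableSubmodule_of_mem_iff_exists_iterate_eq hMst μ j hNMmem
  have hNM'st : IsStableSubmodule (AutomorphyDatum.gl n K hcpt) NM' :=
    isStableSubmodule_of_mem_iff_exists_iterate_eq hMW'st μ j hNM'mem
  have hNM_W : NM ≤ π.1.W := by
    rintro _ ⟨a, ha, rfl⟩
    exact iterate_shiftLie_mem π.1.stable μ j (hMW ha)
  -- `N φ ∈ NM'` forces `φ ∈ W'` (for `φ ∈ M k₀`): the kernel of `N` on `M k₀` is `M j ≤ W'`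
  have key_out : ∀ φ ∈ M k₀, (S[hcpt, μ])^[j] φ ∈ NM' → φ ∈ π.1.W' := by
    rintro φ hφ ⟨a, ha, hEq⟩
    have h0 : (S[hcpt, μ])^[j] (φ - a) = 0 := by
      rw [iterate_shiftLie_sub π.1.stable μ j (hMW hφ) (hMW ha.1), hEq, sub_self]
    have hsub : φ - a ∈ π.1.W' := hker ((hMmem _ _).2 ⟨sub_mem (hMW hφ) (hMW ha.1), h0⟩)
    have : φ = (φ - a) + a := by abel
    rw [this]
    exact add_mem hsub ha.2
  obtain ⟨x₀, hx₀M, hx₀W'⟩ := SetLike.not_le_iff_exists.1 hk₀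
  have hlt : NM' < NM := by
    refine lt_of_le_of_ne hNM'le fun h => hx₀W' (key_out x₀ hx₀M ?_)
    rw [h]
    exact ⟨x₀, hx₀M, rfl⟩
  -- `1` acts by `μ` on `NM`, so `A_G` acts by `a ↦ a^μ`
  have hTNM : ∀ ψ ∈ NM, lieDeriv (AutomorphyDatum.gl n K hcpt).ofArch
      (⟨1, trivial⟩ : (AutomorphyDatum.gl n K hcpt).arch.lie) ψ = μ • ψ := by
    rintro _ ⟨a, ha, rfl⟩
    have h := ((hMmem _ _).1 ha).2
    rw [← hjk, Function.iterate_succ_apply'] at h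
    exact sub_eq_zero.1 h
  have hAG : ∀ ψ ∈ NM, ∀ (t : ℝ≥0ˣ) (g : (AdelicGroupData.gl n K).Adelic),
      ψ ((show (AdelicGroupData.gl n K).Adelic from posRealScalar n K t) * g) =
        (((t : ℝ≥0) : ℝ) : ℂ) ^ μ * ψ g := fun ψ hψ t g =>
    apply_posRealScalar_mul_of_lieDeriv_one_eq_smul (π.1.stable.isArchSmooth (hNM_W hψ)) (hTNM ψ hψ) t g
  -- (D') irreducibility of `NM / NM'` through the lattice isomorphism induced by `N`
  have hirr : ∀ U : Submodule ℂ ((AdelicGroupData.gl n K).Adelic → ℂ), NM' ≤ U → U ≤ NM →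
      IsStableSubmodule (AutomorphyDatum.gl n K hcpt) U → U = NM' ∨ U = NM := by
    intro U hU₁ hU₂ hUst
    -- the pull-back `Ut = M k₀ ∩ N⁻¹(U)`
    let Ut : Submodule ℂ ((AdelicGroupData.gl n K).Adelic → ℂ) :=
      { carrier := {φ | φ ∈ M k₀ ∧ (S[hcpt, μ])^[j] φ ∈ U}
        add_mem' := fun {a b} ha hb => ⟨add_mem ha.1 hb.1, by
          rw [iterate_shiftLie_add π.1.stable μ j (hMW ha.1) (hMW hb.1)]
          exact add_mem ha.2 hb.2⟩
        zero_mem' := ⟨zero_mem _, by rw [iterate_shiftLie_zero μ j]; exact zero_mem _⟩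
        smul_mem' := fun c a ha => ⟨Submodule.smul_mem _ c ha.1, by
          rw [iterate_shiftLie_smul]
          exact Submodule.smul_mem _ c ha.2⟩ }
    have hUtmem : ∀ φ, φ ∈ Ut ↔ φ ∈ M k₀ ∧ (S[hcpt, μ])^[j] φ ∈ U := fun φ => Iff.rfl
    have hUtM : Ut ≤ M k₀ := fun φ hφ => ((hUtmem φ).1 hφ).1
    have hUtst : IsStableSubmodule (AutomorphyDatum.gl n K hcpt) Ut :=
      { le_automorphicForms := fun φ hφ => π.1.stable.le_automorphicForms (hMW (hUtM hφ))
        finite_stable := fun h hh φ hφ => by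
          rw [Submodule.mem_comap, hUtmem]
          refine ⟨hMst.finite_stable h hh ((hUtmem φ).1 hφ).1, ?_⟩
          rw [iterate_shiftLie_rightTranslation]
          exact hUst.finite_stable h hh ((hUtmem φ).1 hφ).2
        k_stable := fun kk φ hφ => by
          rw [Submodule.mem_comap, hUtmem]
          refine ⟨hMst.k_stable kk ((hUtmem φ).1 hφ).1, ?_⟩
          rw [iterate_shiftLie_rightTranslation]
          exact hUst.k_stable kk ((hUtmem φ).1 hφ).2
        lie_stable := fun X φ hφ => by
          rw [hUtmem]
          refine ⟨hMst.lie_stable X φ ((hUtmem φ).1 hφ).1, ?_⟩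
          rw [iterate_shiftLie_lieDeriv π.1.stable μ j X (hMW ((hUtmem φ).1 hφ).1)]
          exact hUst.lie_stable X _ ((hUtmem φ).1 hφ).2 }
    have hW'Ut : M k₀ ⊓ π.1.W' ≤ Ut := fun φ hφ => (hUtmem φ).2 ⟨hφ.1, hU₁ ⟨φ, hφ, rfl⟩⟩
    rcases π.1.irreducible (Ut ⊔ π.1.W') le_sup_right (sup_le (hUtM.trans hMW) π.1.lt.le)
        (hUtst.sup π.1.stable') with h | h
    · -- `Ut ≤ W'`: then `U = N(Ut) ≤ N(M k₀ ∩ W') = NM'`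
      left
      refine le_antisymm (fun u hu => ?_) hU₁
      obtain ⟨φ, hφM, rfl⟩ := (hNMmem _).1 (hU₂ hu)
      have hφUt : φ ∈ Ut := (hUtmem φ).2 ⟨hφM, hu⟩
      have hφW' : φ ∈ π.1.W' := by
        have hφ' : φ ∈ Ut ⊔ π.1.W' := Submodule.mem_sup_left hφUt
        rwa [h] at hφ'
      exact ⟨φ, ⟨hφM, hφW'⟩, rfl⟩
    · -- `Ut + W' = W`: then `M k₀ ≤ Ut`, so `NM ≤ U`
      right
      refine le_antisymm hU₂ ?_
      rintro _ ⟨φ, hφM, rfl⟩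
      have hφmem : φ ∈ Ut ⊔ π.1.W' := by
        rw [h]
        exact hMW hφM
      obtain ⟨u, hu, w, hw, huw⟩ := Submodule.mem_sup.1 hφmem
      have hwM : w ∈ M k₀ := by
        have hw' : w = φ - u := by rw [← huw]; abel
        rw [hw']
        exact sub_mem hφM (hUtM hu)
      have hφUt : φ ∈ Ut := by
        rw [← huw]
        exact add_mem hu (hW'Ut ⟨hwM, hw⟩)
      exact ((hUtmem φ).1 hφUt).2
  -- the eigen-model `π₁ = NM / NM'`
  let π₁ : CuspidalAutomorphicRepData n K hcpt :=
    ⟨{ W := NM, W' := NM', lt := hlt, stable := hNMst, stable' := hNM'st, irreducible := hirr },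
      hNM_W.trans π.2⟩
  -- `N = S_μ^j` detects `W'` on `M k₀`
  have hkey : ∀ φ ∈ M k₀, (S[hcpt, μ])^[j] φ ∈ NM' ↔ φ ∈ π.1.W' := fun φ hφ =>
    ⟨key_out φ hφ, fun hW' => ⟨φ, ⟨hφ, hW'⟩, rfl⟩⟩
  -- `τ` and right translations: `τ⋆ (r(h) φ) = r(τ h) (τ⋆ φ)`
  have hτR : ∀ (h : (AdelicGroupData.gl n K).Adelic) (φ : (AdelicGroupData.gl n K).Adelic → ℂ),
      τ𝔸⋆ (rightTranslation (AdelicGroupData.gl n K) h φ) =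
        rightTranslation (AdelicGroupData.gl n K) (τ𝔸[h]) (τ𝔸⋆ φ) := fun h φ => by
    rw [rightTranslation_funLeft_weylLong_mul_glTransposeInv_mul_weylLong,
      weylLong_mul_glTransposeInv_mul_weylLong_involutive]
  have hτfin : ∀ h ∈ (AutomorphyDatum.gl n K hcpt).finiteAdelic,
      (τ𝔸[h]) ∈ (AutomorphyDatum.gl n K hcpt).finiteAdelic := fun h hh =>
    weylLong_mul_glTransposeInv_mul_weylLong_mem_range_ofFinite hh
  have hmemτ : ∀ (W₀ : Submodule ℂ ((AdelicGroupData.gl n K).Adelic → ℂ)) (ψ : (AdelicGroupData.gl n K).Adelic → ℂ),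
      ψ ∈ W₀.map τ𝔸⋆ ↔ τ𝔸⋆ ψ ∈ W₀ :=
    mem_map_funLeft_weylLong_mul_glTransposeInv_mul_weylLong_iff
  have hττ : ∀ ψ : (AdelicGroupData.gl n K).Adelic → ℂ, τ𝔸⋆ (τ𝔸⋆ ψ) = ψ :=
    funLeft_weylLong_mul_glTransposeInv_mul_weylLong_involutive
  -- abstract the involution `τ⋆` as an OPAQUE linear map `T` with its four properties (keeps the
  -- matrix expression `w₀ ᵗg⁻¹ w₀` out of all further unification problems)
  obtain ⟨T, hTR, hTT, hTmem, hTW, hTW'⟩ :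
      ∃ T : ((AdelicGroupData.gl n K).Adelic → ℂ) →ₗ[ℂ] ((AdelicGroupData.gl n K).Adelic → ℂ),
        (∀ h ∈ (AutomorphyDatum.gl n K hcpt).finiteAdelic,
          ∃ h' ∈ (AutomorphyDatum.gl n K hcpt).finiteAdelic,
            (∀ φ, T (rightTranslation (AdelicGroupData.gl n K) h φ) =
              rightTranslation (AdelicGroupData.gl n K) h' (T φ)) ∧
            (∀ φ, T (rightTranslation (AdelicGroupData.gl n K) h' φ) =
              rightTranslation (AdelicGroupData.gl n K) h (T φ))) ∧
        (∀ ψ, T (T ψ) = ψ) ∧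
        (∀ (W₀ : Submodule ℂ ((AdelicGroupData.gl n K).Adelic → ℂ)) ψ, ψ ∈ W₀.map T ↔ T ψ ∈ W₀) ∧
        (∀ σ : AutomorphicRepData (AutomorphyDatum.gl n K hcpt), σ.transposeInv.W = σ.W.map T) ∧
        (∀ σ : AutomorphicRepData (AutomorphyDatum.gl n K hcpt), σ.transposeInv.W' = σ.W'.map T) :=
    ⟨τ𝔸⋆, fun h hh => ⟨τ𝔸[h], hτfin h hh, fun φ => hτR h φ, fun φ => by
        rw [hτR, weylLong_mul_glTransposeInv_mul_weylLong_involutive]⟩,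
      hττ, hmemτ, fun σ => rfl, fun σ => rfl⟩
  -- the `τ`-side data: `M k₀ ∘ τ` and `τ⋆ ∘ N ∘ τ⋆`
  have hMBτ : (M k₀).map T ≤ π.1.transposeInv.W := by
    rw [hTW]
    exact Submodule.map_mono hMW
  have hMstτ : ∀ h ∈ (AutomorphyDatum.gl n K hcpt).finiteAdelic, ∀ φ ∈ (M k₀).map T,
      rightTranslation (AdelicGroupData.gl n K) h φ ∈ (M k₀).map T := fun h hh φ hφ => by
    obtain ⟨h', hh', e1, -⟩ := hTR h hh
    rw [hTmem] at hφ ⊢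
    have h1 := hMst.finite_stable h' hh' hφ
    rw [Submodule.mem_comap] at h1
    rw [e1]
    exact h1
  have hNaddτ : ∀ a ∈ (M k₀).map T, ∀ b ∈ (M k₀).map T,
      T ((S[hcpt, μ])^[j] (T (a + b))) = T ((S[hcpt, μ])^[j] (T a)) + T ((S[hcpt, μ])^[j] (T b)) :=
    fun a ha b hb => by
      rw [hTmem] at ha hb
      rw [map_add, iterate_shiftLie_add π.1.stable μ j (hMW ha) (hMW hb), map_add]
  have hNsmulτ : ∀ (c : ℂ) (a : (AdelicGroupData.gl n K).Adelic → ℂ),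
      T ((S[hcpt, μ])^[j] (T (c • a))) = c • T ((S[hcpt, μ])^[j] (T a)) := fun c a => by
    rw [map_smul, iterate_shiftLie_smul, map_smul]
  have hNRτ : ∀ h ∈ (AutomorphyDatum.gl n K hcpt).finiteAdelic, ∀ φ ∈ (M k₀).map T,
      T ((S[hcpt, μ])^[j] (T (rightTranslation (AdelicGroupData.gl n K) h φ))) =
        rightTranslation (AdelicGroupData.gl n K) h (T ((S[hcpt, μ])^[j] (T φ))) :=
    fun h hh φ _ => by
      obtain ⟨h', -, e1, e2⟩ := hTR h hh
      rw [e1, iterate_shiftLie_rightTranslation, e2]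
  have hAWτ : ∀ ψ, ψ ∈ π₁.1.transposeInv.W ↔
      ∃ φ ∈ (M k₀).map T, T ((S[hcpt, μ])^[j] (T φ)) = ψ := fun ψ => by
    rw [hTW]
    change ψ ∈ NM.map T ↔ _
    rw [hTmem, hNMmem]
    constructor
    · rintro ⟨φ₀, hφ₀, hEq⟩
      refine ⟨T φ₀, (hTmem _ _).2 (by rw [hTT]; exact hφ₀), ?_⟩
      rw [hTT, hEq, hTT]
    · rintro ⟨φ, hφ, rfl⟩
      rw [hTmem] at hφ
      exact ⟨T φ, hφ, by rw [hTT]⟩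
  have hkeyτ : ∀ φ ∈ (M k₀).map T,
      T ((S[hcpt, μ])^[j] (T φ)) ∈ π₁.1.transposeInv.W' ↔ φ ∈ π.1.transposeInv.W' := fun φ hφ => by
    rw [hTmem] at hφ
    rw [hTW', hTW']
    change T ((S[hcpt, μ])^[j] (T φ)) ∈ NM'.map T ↔ φ ∈ π.1.W'.map T
    rw [hTmem, hTT, hTmem]
    exact hkey _ hφ
  refine ⟨π₁, μ, fun ψ hψ t g => hAG ψ hψ t g, fun v V _ _ ρ hρ => ?_, fun v V _ _ ρ hρ => ?_⟩
  · -- transfer along `N = S_μ^j` on `M k₀`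
    exact AutomorphicRepData.hasLocalComponentAt_of_model (A := π₁.1) (B := π.1) (M k₀) hMW
      (fun h hh φ hφ => hMst.finite_stable h hh hφ) (fun φ => (S[hcpt, μ])^[j] φ)
      (fun a ha b hb => iterate_shiftLie_add π.1.stable μ j (hMW ha) (hMW hb))
      (fun c a => iterate_shiftLie_smul μ j c a)
      (fun h _ φ _ => iterate_shiftLie_rightTranslation μ j h φ)
      (fun ψ => hNMmem ψ) hkey hρ
  · -- transfer along `T ∘ N ∘ T` on `M k₀ ∘ τ` (`(π₁^τ).W = NM ∘ τ`, `(π^τ).W' = W' ∘ τ`)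
    exact AutomorphicRepData.hasLocalComponentAt_of_model (A := π₁.1.transposeInv)
      (B := π.1.transposeInv) ((M k₀).map T) hMBτ hMstτ
      (fun φ => T ((S[hcpt, μ])^[j] (T φ))) hNaddτ hNsmulτ hNRτ hAWτ hkeyτ hρ

end Literature.NumberTheory.Automorphic

end
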